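import Literature.Computability.QuantumComplexity.FactoringUP
import Literature.Computability.QuantumComplexity.PrimesUP
import HarnessLib

/-!
# Factoring is in `UP ∩ coUP`, given a primality test for factored `p − 1` beyond a threshold

Family `PQC`; the junction of `FactoringUP.lean` (`FACT_mem_UP_inter_coUP_of_PRIMES_mem_UP`: with
unambiguous primality certificates the sorted prime factorisation is the unique witness on both sides)
and `PrimesUP.lean` (`PRIMES_mem_UP_of_isFactoredPrimalityTest`: the choice-free Lucas tree is an
unambiguous certificate of primality as soon as a polynomial-time brick `T` decides primality of `r`
from `⟨r, primeFactorsList (r − 1)⟩`). Fellows–Koblitz's Lemma 1 provides such a test only *from some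
`p₀` on* ("`Ψ(p, log³ p) ≥ p^{1/2}` for `p ≥ p₀`"; in the tree `size p ≥ 1024`,
`Literature/NumberTheory/Primality/FellowsKoblitz.lean`). This file removes the threshold and closes
the chain:

* `PrimesUP.smallPrimeFn B` — primality of numbers `≤ B + 1` by trial division, a counted loop of the
  brick algebra clocked by the *constant* polynomial `B` (so in `FP` for every fixed `B`, however
  large), with `smallPrimeFn_encodeNat : smallPrimeFn B (encodeNat r) = [r.Prime]` for `r ≤ B + 1`;
* `PrimesUP.thresholdTest B T` — below `B` trial division, from `B` on the given `T`;
  `isFactoredPrimalityTest_thresholdTest`: a test correct for `p ≥ B` yields an `IsFactoredPrimalityTest`;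
* **`FACT_mem_UP_inter_coUP_of_isFactoredPrimalityTest`** and
  **`FACT_mem_UP_inter_coUP_of_thresholdTest`**: `FACT_mem_UP_inter_coUP` (pqc.S26, `Factoring.lean`)
  from any brick `T ∈ FP`, one-bit, with `T ⟨encodeNat p, encList (primeFactorsList (p − 1))⟩ = [p is prime]`
  for all `p ≥ B` (any `B`) — the machine form of Fellows–Koblitz 1992, Lemma 1, which is developed
  elsewhere in the tree and not restated here; a primality test in `P` also suffices
  (`FACT_mem_UP_inter_coUP_of_PRIMES_mem_P`).

## References

* M. R. Fellows, N. Koblitz, *Self-witnessing polynomial-time complexity and prime factorization*,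
  Designs, Codes and Cryptography 2 (1992) 231–235: §2, Lemma 1 ("for some effectively computable `p₀`")
  and the proof of Thm. 1 (held: `doi:10.1007/bf00141967`, pp. 2–4).
* S. Arora, B. Barak, *Computational Complexity: A Modern Approach*, CUP 2009, §1.3 (bounded loops),
  Example 2.3, Def. 9.14.
-/

namespace Literature.Computability.QuantumComplexity

open _root_.Computability Complexity Complexity.Classes Complexity.Nondeterministic Complexity.Brick Polynomial
open Literature.Computability.Complexity.HashBricks

namespace PrimesUP

/-! ### Primality below a fixed bound by trial division (a counted loop) -/

/-- The body of the trial-division loop on records `⟨x, ⟨d, flag⟩⟩`: the new flag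
`[flag ∧ (⟦d⟧ < 2 ∨ ⟦x⟧ mod ⟦d⟧ ≠ 0)]`. [folklore] -/
noncomputable def tdBody : List Bool → List Bool :=
  andFn (headBitFn ∘ sndPow 1)
    (orFn (ltFn ∘ fanoutFn (nthF 1) (fun _ => encodeNat 2)) (notFn (isNilFn ∘ remFn ∘ fanoutFn (nthF 0) (nthF 1))))

/-- `tdBody ∈ FP`. [folklore] -/
theorem tdBody_mem_FP : tdBody ∈ FP :=
  andFn_mem_FP (comp_mem_FP headBitFn_mem_FP (sndPow_mem_FP 1))
    (orFn_mem_FP (comp_mem_FP ltFn_mem_FP (fanoutFn_mem_FP (nthF_mem_FP 1) (const_mem_FP _)))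
      (notFn_mem_FP (comp_mem_FP isNilFn_mem_FP (comp_mem_FP remFn_mem_FP (fanoutFn_mem_FP (nthF_mem_FP 0) (nthF_mem_FP 1))))))

/-- `tdBody` is one-bit. [folklore] -/
theorem oneBit_tdBody : OneBit tdBody :=
  oneBit_andFn (oneBit_headBitFn.comp _) (oneBit_orFn (oneBit_ltFn.comp _) (oneBit_notFn (oneBit_isNilFn.comp _)))

/-- Value of the body on a record. [folklore] -/
theorem tdBody_apply (x : List Bool) (d : ℕ) (b : Bool) :
    tdBody (boolPair x (boolPair (encodeNat d) [b])) = [b && (decide (d < 2) || !decide (bitsToNat x % d = 0))] := by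
  have h1 : (headBitFn ∘ sndPow 1) (boolPair x (boolPair (encodeNat d) [b])) = [b] := by simp [sndPow]
  have h2 : (ltFn ∘ fanoutFn (nthF 1) (fun _ => encodeNat 2)) (boolPair x (boolPair (encodeNat d) [b])) = [decide (d < 2)] := by
    simp
  have hnil : ∀ m : ℕ, encodeNat m = [] ↔ m = 0 := fun m =>
    ⟨fun h => by simpa using congrArg bitsToNat h, fun h => h ▸ rfl⟩
  have h3 : (isNilFn ∘ remFn ∘ fanoutFn (nthF 0) (nthF 1)) (boolPair x (boolPair (encodeNat d) [b])) =
      [decide (bitsToNat x % d = 0)] := by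
    simp only [Function.comp_apply, fanoutFn_apply, nthF_zero, fstF_boolPair, nthF_succ_boolPair,
      remFn_boolPair, bitsToNat_encodeNat, isNilFn, hnil]
  rw [tdBody, andFn_apply h1 (orFn_apply h2 (notFn_apply h3))]

/-- The model of the loop: the flag collects `d < 2 ∨ ⟦x⟧ mod d ≠ 0` for `d = k, k − 1, …, 1` (and,
harmlessly, `d = 0`). [folklore] -/
theorem loopModel_tdBody (x : List Bool) : ∀ (k : ℕ) (b : Bool),
    loopModel tdBody x k [b] = [b && decide (∀ d ≤ k, d < 2 ∨ bitsToNat x % d ≠ 0)]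
  | 0, b => by
    rw [loopModel]
    simp
  | k + 1, b => by
    have hx : ((decide (k + 1 < 2) || !decide (bitsToNat x % (k + 1) = 0)) &&
          decide (∀ d ≤ k, d < 2 ∨ bitsToNat x % d ≠ 0)) =
        decide (∀ d ≤ k + 1, d < 2 ∨ bitsToNat x % d ≠ 0) := by
      rw [Bool.eq_iff_iff]
      simp only [Bool.and_eq_true, Bool.or_eq_true, decide_eq_true_eq, Bool.not_eq_true', decide_eq_false_iff_not,
        ne_eq]
      constructor
      · rintro ⟨hk1, hall⟩ d hdk
        rcases Nat.lt_or_ge d (k + 1) with hlt | hge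
        · exact hall d (by omega)
        · have : d = k + 1 := by omega
          subst this
          exact hk1
      · intro hall
        exact ⟨hall (k + 1) le_rfl, fun d hdk => hall d (by omega)⟩
    rw [loopModel, tdBody_apply, loopModel_tdBody x k, Bool.and_assoc, hx]

/-- The initial record `x ↦ ⟨x, ⟨encodeNat (⟦x⟧ − 1), [1]⟩⟩`. [folklore] -/
noncomputable def tdInit : List Bool → List Bool :=
  fanoutFn id (fanoutFn (subFn ∘ fanoutFn id (fun _ => [true])) (fun _ => [true]))

/-- `tdInit ∈ FP`. [folklore] -/
theorem tdInit_mem_FP : tdInit ∈ FP :=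
  fanoutFn_mem_FP (PolyTimeComputable.id _)
    (fanoutFn_mem_FP (comp_mem_FP subFn_mem_FP (fanoutFn_mem_FP (PolyTimeComputable.id _) (const_mem_FP _))) (const_mem_FP _))

/-- Value of `tdInit`. [folklore] -/
theorem tdInit_apply (x : List Bool) : tdInit x = boolPair x (boolPair (encodeNat (bitsToNat x - 1)) [true]) := by
  simp [tdInit]

/-- **The trial-division loop** with `B` rounds (a constant polynomial clock). [cite: AroraBarakCC2009, §1.3 (bounded loops)] -/
noncomputable def tdLoop (B : ℕ) : List Bool → List Bool :=
  fun z => (loopStep tdBody)^[(Polynomial.C B).eval (fstF z).length] z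

/-- `tdLoop B ∈ FP`. [cite: AroraBarakCC2009, §1.3] -/
theorem tdLoop_mem_FP (B : ℕ) : tdLoop B ∈ FP :=
  loopFn_mem_FP tdBody_mem_FP (c := 1) (fun z => by rw [oneBit_tdBody.length_eq]; omega) (Polynomial.C B)

/-- **Primality below `B` by trial division** `smallPrimeFn B`: `2 ≤ ⟦x⟧` and the flag of the loop started
at `d = ⟦x⟧ − 1`. [folklore] -/
noncomputable def smallPrimeFn (B : ℕ) : List Bool → List Bool :=
  andFn valGeTwoFn (headBitFn ∘ sndPow 1 ∘ tdLoop B ∘ tdInit)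

/-- `smallPrimeFn B ∈ FP`. [folklore] -/
theorem smallPrimeFn_mem_FP (B : ℕ) : smallPrimeFn B ∈ FP :=
  andFn_mem_FP valGeTwoFn_mem_FP (comp_mem_FP headBitFn_mem_FP (comp_mem_FP (sndPow_mem_FP 1)
    (comp_mem_FP (tdLoop_mem_FP B) tdInit_mem_FP)))

/-- `smallPrimeFn B` is one-bit. [folklore] -/
theorem oneBit_smallPrimeFn (B : ℕ) : OneBit (smallPrimeFn B) := oneBit_andFn oneBit_valGeTwoFn (oneBit_headBitFn.comp _)

/-- **Value of `smallPrimeFn B` below the bound**: the primality of `r ≤ B + 1`. [folklore] -/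
theorem smallPrimeFn_encodeNat {B r : ℕ} (hr : r ≤ B + 1) : smallPrimeFn B (encodeNat r) = [decide r.Prime] := by
  have hloop : (headBitFn ∘ sndPow 1 ∘ tdLoop B ∘ tdInit) (encodeNat r) =
      [decide (∀ d ≤ r - 1, d < 2 ∨ r % d ≠ 0)] := by
    simp only [Function.comp_apply, tdInit_apply, bitsToNat_encodeNat, tdLoop, fstF_boolPair, Polynomial.eval_C]
    rw [iterate_loopStep tdBody (encodeNat r) (r - 1) B [true] (by omega), loopModel_tdBody]
    simp [sndPow]
  rw [smallPrimeFn, andFn_apply (b := decide (2 ≤ r)) (by simp [valGeTwoFn]) hloop, ← Bool.decide_and]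
  congr 1
  apply decide_eq_decide.2
  rw [Nat.prime_def_lt]
  refine and_congr_right fun h2 => ⟨fun h m hm hdvd => ?_, fun h d hdr => ?_⟩
  · rcases Nat.lt_or_ge m 2 with hm2 | hm2
    · interval_cases m
      · exact absurd (Nat.eq_zero_of_zero_dvd hdvd) (by omega)
      · rfl
    · exact absurd (Nat.mod_eq_zero_of_dvd hdvd) ((h m (by omega)).resolve_left (by omega))
  · by_cases hd2 : d < 2
    · exact Or.inl hd2
    · refine Or.inr fun hmod => ?_
      have := h d (by omega) (Nat.dvd_of_mod_eq_zero hmod)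
      omega

/-! ### Removing a threshold from a factored-primality test -/

/-- **The threshold test**: below `B` decide by trial division (ignoring the factor list), from `B` on
ask `T`. [folklore] -/
noncomputable def thresholdTest (B : ℕ) (T : List Bool → List Bool) : List Bool → List Bool :=
  iteFn (ltFn ∘ fanoutFn fstF (fun _ => encodeNat B)) (smallPrimeFn B ∘ fstF) T

/-- `thresholdTest B T ∈ FP` for `T ∈ FP`. [folklore] -/
theorem thresholdTest_mem_FP (B : ℕ) {T : List Bool → List Bool} (hT : T ∈ FP) : thresholdTest B T ∈ FP :=
  iteFn_mem_FP (comp_mem_FP ltFn_mem_FP (fanoutFn_mem_FP fstF_mem_FP (const_mem_FP _)))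
    (comp_mem_FP (smallPrimeFn_mem_FP B) fstF_mem_FP) hT

/-- `thresholdTest B T` is one-bit for a one-bit `T`. [folklore] -/
theorem oneBit_thresholdTest (B : ℕ) {T : List Bool → List Bool} (h1 : OneBit T) : OneBit (thresholdTest B T) :=
  (oneBit_ltFn.comp _).ite ((oneBit_smallPrimeFn B).comp _) h1

/-- **Value of the threshold test** on `⟨encodeNat p, F⟩`. [folklore] -/
theorem thresholdTest_boolPair (B : ℕ) (T : List Bool → List Bool) (p : ℕ) (F : List Bool) :
    thresholdTest B T (boolPair (encodeNat p) F) =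
      if p < B then [decide p.Prime] else T (boolPair (encodeNat p) F) := by
  rw [thresholdTest, iteFn_of_oneBit (oneBit_ltFn.comp _)]
  simp only [Function.comp_apply, fanoutFn_apply, fstF_boolPair, ltFn_boolPair, bitsToNat_encodeNat,
    List.singleton_inj, decide_eq_true_eq]
  split_ifs with h
  · exact smallPrimeFn_encodeNat (by omega)
  · rfl

end PrimesUP

open PrimesUP

/-! ### Removing the threshold, and the reduction of pqc.S26 -/

/-- **A factored-primality test from a threshold on is one everywhere**: if `T ∈ FP` is one-bit and
answers `[p is prime]` on `⟨encodeNat p, encList (primeFactorsList (p − 1))⟩` for every `p ≥ B`, then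
`thresholdTest B T` is an `IsFactoredPrimalityTest` (Fellows–Koblitz's "for `p ≥ p₀`", the finitely
many smaller `p` by trial division). [cite: FellowsKoblitz1992, §2 (Lemma 1)] -/
theorem isFactoredPrimalityTest_thresholdTest {B : ℕ} {T : List Bool → List Bool} (hT : T ∈ FP) (h1 : OneBit T)
    (hc : ∀ p : ℕ, B ≤ p → 2 ≤ p →
      T (boolPair (encodeNat p) (encList (((p - 1).primeFactorsList).map encodeNat))) = [decide p.Prime]) :
    IsFactoredPrimalityTest (thresholdTest B T) where
  mem_FP := thresholdTest_mem_FP B hT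
  oneBit := oneBit_thresholdTest B h1
  correct p hp := by
    rw [thresholdTest_boolPair]
    split_ifs with h
    · rfl
    · exact hc p (Nat.le_of_not_lt h) hp

/-- **pqc.S26 (`UP` form), reduced to a polynomial-time primality test for factored `p − 1`**: if some
brick `T` of the `FP` algebra decides primality of `p ≥ 2` from `⟨p, primeFactorsList (p − 1)⟩`, then
`FACT ∈ UP ∩ coUP` — via `PRIMES_mem_UP_of_isFactoredPrimalityTest` (unambiguous Lucas-tree
certificates) and `FACT_mem_UP_inter_coUP_of_PRIMES_mem_UP` (the sorted factorisation as the unique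
witness). [cite: FellowsKoblitz1992, §2 (Lemma 1 and proof of Thm. 1)] -/
theorem FACT_mem_UP_inter_coUP_of_isFactoredPrimalityTest {T : List Bool → List Bool}
    (hT : IsFactoredPrimalityTest T) : FACT_mem_UP_inter_coUP :=
  FACT_mem_UP_inter_coUP_of_PRIMES_mem_UP (PRIMES_mem_UP_of_isFactoredPrimalityTest hT)

/-- **pqc.S26 (`UP` form) from Fellows–Koblitz's Lemma 1 in machine form**: a brick `T ∈ FP`, one-bit,
answering `[p is prime]` on `⟨encodeNat p, encList (primeFactorsList (p − 1))⟩` for all `p` from some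
threshold `B` on, gives `FACT ∈ UP ∩ coUP`. [cite: FellowsKoblitz1992, §2 (Lemma 1 and proof of Thm. 1)] -/
theorem FACT_mem_UP_inter_coUP_of_thresholdTest
    (h : ∃ (B : ℕ) (T : List Bool → List Bool), T ∈ FP ∧ OneBit T ∧
      ∀ p : ℕ, B ≤ p → 2 ≤ p →
        T (boolPair (encodeNat p) (encList (((p - 1).primeFactorsList).map encodeNat))) = [decide p.Prime]) :
    FACT_mem_UP_inter_coUP := by
  obtain ⟨B, T, hT, h1, hc⟩ := h
  exact FACT_mem_UP_inter_coUP_of_isFactoredPrimalityTest (isFactoredPrimalityTest_thresholdTest hT h1 hc)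

/-- The same with the threshold on the bit size (`size p ≥ s`, the form of the tree's Fellows–Koblitz
development, `s = 1024`). [cite: FellowsKoblitz1992, §2 (Lemma 1 and proof of Thm. 1)] -/
theorem FACT_mem_UP_inter_coUP_of_sizeThresholdTest
    (h : ∃ (s : ℕ) (T : List Bool → List Bool), T ∈ FP ∧ OneBit T ∧
      ∀ p : ℕ, s ≤ p.size → 2 ≤ p →
        T (boolPair (encodeNat p) (encList (((p - 1).primeFactorsList).map encodeNat))) = [decide p.Prime]) :
    FACT_mem_UP_inter_coUP := by
  obtain ⟨s, T, hT, h1, hc⟩ := h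
  refine FACT_mem_UP_inter_coUP_of_thresholdTest ⟨2 ^ s, T, hT, h1, fun p hB hp => hc p ?_ hp⟩
  exact (Nat.lt_size.2 hB).le

end Literature.Computability.QuantumComplexity
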